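import Summits.CriticalPhenomena.SAWScalingLimit.Theses.SAWCompassLattice
import Summits.CriticalPhenomena.SAWScalingLimit.Theses.SAWTrackTransport
import Summits.CriticalPhenomena.SAWScalingLimit.Theorems.SAWDevelopingMapHexTransferPortDictionary
import Summits.CriticalPhenomena.SAWScalingLimit.Theorems.SAWDevelopingMapHexTransferPortTransfer
import Summits.CriticalPhenomena.SAWScalingLimit.Theorems.SAWDevelopingMapHexTransferLineReduction
import Summits.CriticalPhenomena.SAWScalingLimit.Theorems.SAWCompassLatticeSurfaceUniversalityNonVacuity
import Literature.Probability.RandomPlanarGeometry.SLEUniquenessInLaw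

/-!
# Toll reduction for the crux `SurfaceUniversality` (stmt-CriticalPhenomena-6964) — cross-reference,
# NOT the registered line (that is `Lines/birth.lean`)

Refuter route-review objection (b) (2026-08-15, notes on stmt-6964): "given PortDictionary (6966) +
the deterministic O(δ) port coupling, SurfaceUniversality is the SAME comparison as YBtoUniform (GM's
θ = π/2 face-walk law vs the uniform ℤ² law) … glue 0809 + 6966 + coupling → 6964 or cross-reference,
so the two are not attacked twice."

This file records the honest form of that glue, sorry-free. The coupling passes a LIMIT along
(bounded-Lipschitz portmanteau), not a limit-free difference of test integrals of merely continuous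
`f` (no tightness of the critical Yang–Baxter walk is known), so the glue needs the SLE(8/3)
identification of GM's walk, `YBSquareSLE` (stmt-6967) — which route `SAWCompassLattice` bets on anyway
through `CompassSLE`:

* `Cruxes.HexTransfer.Sketch.stub_portDictionary : PortDictionary` (item 6966) and
  `Cruxes.HexTransfer.Sketch.stub_portTransfer : PortDictionary → YBSquareSLE → CompassSLE` are THEOREMS
  of the tree (`Theorems/SAWDevelopingMapHexTransferPortDictionary*.lean`, `…PortTransfer*.lean`);
* two families converging in law to chordal SLE(8/3) random curves of one Dobrushin domain have
  asymptotically equal test integrals (`tendsto_sub_of_sle`, from `IsSLECurve.map_eq_holds`);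
* hence `YBSquareSLE → (ybLaw(π/2) and the compass law merge)` (`yb_compass_merge`), and adding the
  toll `SAWTrackTransport.YBtoUniform` (stmt-16966: `SAW.law` and `ybLaw(π/2)` merge) gives the crux:
  **`surfaceUniversality_of_toll : YBSquareSLE → YBtoUniform → SurfaceUniversality`**.

Consequences worth knowing when staffing: with the landed
`Sketch.sawScalingLimit_of_ybSquareSLE_of_surfaceUniversality : YBSquareSLE → SurfaceUniversality →
SAWScalingLimit`, route `SAWCompassLattice` as a whole now reduces to the two open items
`YBSquareSLE` (6967) ∧ `YBtoUniform` (16966) (`sawScalingLimit_of_toll`); conversely the registered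
line of `Lines/birth.lean` (plus point / surface transport) is a limit-free attack on BOTH 6964 and,
given 6967, on 16966 (`ybToUniform_of_surfaceUniversality`). A prover may land this file verbatim under
`Theorems/` with `--supports stmt-CriticalPhenomena-6964` once stub registration permits, or as the
proof of 6964 the day 6967 and 16966 close.
-/

noncomputable section

namespace Summit.CriticalPhenomena.SAWScalingLimit.Cruxes.SurfaceUniversality.Toll

open MeasureTheory Filter Topology Set
open scoped NNReal ENNReal BoundedContinuousFunction
open Literature.Probability.RandomPlanarGeometry
open Literature.Probability.RandomPlanarGeometry.SAW
open Literature.Probability.RandomPlanarGeometry.SAW.YangBaxter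
open Literature.Probability.LatticeModels (Site)
open Summit.CriticalPhenomena.SAWScalingLimit.Theses
open Summit.CriticalPhenomena.SAWScalingLimit.Cruxes.HexTransfer (Sketch.stub_portDictionary
  Sketch.stub_portTransfer Sketch.stub_compassRealisation
  Sketch.sawScalingLimit_of_ybSquareSLE_of_surfaceUniversality)

/-- Two families converging in law to chordal SLE(8/3) random curves of the same Dobrushin domain have
asymptotically equal test integrals: the two limit laws coincide (`IsSLECurve.map_eq_holds`).
[folklore] -/
theorem tendsto_sub_of_sle {Ω₁ Ω₂ : ℝ → Type*} [∀ δ, MeasurableSpace (Ω₁ δ)]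
    [∀ δ, MeasurableSpace (Ω₂ δ)] {D : DobrushinDomain} {Y₁ : ∀ δ, Ω₁ δ → CurveClass ℂ}
    {P₁ : ∀ δ, Measure (Ω₁ δ)} {Y₂ : ∀ δ, Ω₂ δ → CurveClass ℂ} {P₂ : ∀ δ, Measure (Ω₂ δ)}
    {Γ₁ Γ₂ : (ℝ≥0 → ℝ) → CurveClass ℂ} (hΓ₁ : IsSLECurve ((8 : ℝ≥0) / 3) D Γ₁)
    (hΓ₂ : IsSLECurve ((8 : ℝ≥0) / 3) D Γ₂)
    (h₁ : TendstoLaw Y₁ P₁ Γ₁ Literature.Probability.Process.preWienerMeasure)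
    (h₂ : TendstoLaw Y₂ P₂ Γ₂ Literature.Probability.Process.preWienerMeasure)
    (f : BoundedContinuousFunction (CurveClass ℂ) ℝ) :
    Tendsto (fun δ => (∫ ω, f (Y₁ δ ω) ∂P₁ δ) - ∫ ω, f (Y₂ δ ω) ∂P₂ δ) (𝓝[>] (0 : ℝ)) (𝓝 0) := by
  have hint : ∫ ω, f (Γ₁ ω) ∂Literature.Probability.Process.preWienerMeasure =
      ∫ ω, f (Γ₂ ω) ∂Literature.Probability.Process.preWienerMeasure := by
    rw [← integral_map hΓ₁.1 f.continuous.aestronglyMeasurable,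
      ← integral_map hΓ₂.1 f.continuous.aestronglyMeasurable, IsSLECurve.map_eq_holds hΓ₁ hΓ₂]
  have h := (h₁ f).sub (h₂ f)
  rwa [hint, sub_self] at h

/-- **Under `YBSquareSLE`, GM's critical square-tiling law and the compass chordal law merge** on
bounded continuous test functions, for every compass solution, Dobrushin domain and port endpoint
approximation: `CompassSLE` holds (landed port dictionary + port transfer), both families converge to
chordal SLE(8/3) curves of `D`, and SLE(8/3) in `D` is one law. [folklore] -/
theorem yb_compass_merge (hY : SAWCompassLattice.YBSquareSLE) :
    ∀ (α β s z : ℝ), IsCompassSolution α β s z →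
      ∀ (D : DobrushinDomain) (a' b' : ℝ → MidEdge), IsYBEndpointApprox rightAngles D a' b' →
        ∀ f : BoundedContinuousFunction (CurveClass ℂ) ℝ,
          Tendsto (fun δ : ℝ =>
              (∫ γ, f (γ.curve rightAngles δ) ∂(ybLaw rightAngles D.carrier δ 1 (a' δ) (b' δ))) -
                ∫ x, f x ∂(SAW.compassLaw α β s z D.carrier δ (a' δ) (b' δ)))
            (𝓝[>] (0 : ℝ)) (𝓝 0) := by
  intro α β s z hsol D a' b' hab' f
  have hC : SAWCompassLattice.CompassSLE := Sketch.stub_portTransfer Sketch.stub_portDictionary hY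
  obtain ⟨Γ₁, hΓ₁, -, hT₁⟩ := hY D a' b' hab'
  obtain ⟨Γ₂, hΓ₂, -, hT₂⟩ := hC α β s z hsol D a' b' hab'
  exact tendsto_sub_of_sle hΓ₁ hΓ₂ hT₁ hT₂ f

/-- **The toll reduction** (refuter objection (b) made honest): chordal SLE(8/3) convergence of GM's
critical Yang–Baxter walk on the square tiling (`YBSquareSLE`, stmt-6967) and the Yang–Baxter ↔ uniform
`ℤ²` toll (`SAWTrackTransport.YBtoUniform`, stmt-16966) imply `SurfaceUniversality` (stmt-6964):
`(∫dP^{ℤ²} − ∫dYB) + (∫dYB − ∫dCompass) → 0`. [folklore] -/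
theorem surfaceUniversality_of_toll (hY : SAWCompassLattice.YBSquareSLE)
    (hT : SAWTrackTransport.YBtoUniform) : SAWCompassLattice.SurfaceUniversality := by
  refine Cruxes.HexTransfer.Sketch.Surface.surfaceUniversality_iff.2 ?_
  intro α β s z hsol D a b a' b' hab hab' f
  have h := (hT D a b a' b' hab hab' f).add (yb_compass_merge hY α β s z hsol D a' b' hab' f)
  rw [add_zero] at h
  exact h.congr fun δ => sub_add_sub_cancel _ _ _

/-- **Route `SAWCompassLattice` minus everything landed**: its conjunct `SAWScalingLimit` follows from
`YBSquareSLE` (6967) and `YBtoUniform` (16966) alone. [folklore] -/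
theorem sawScalingLimit_of_toll (hY : SAWCompassLattice.YBSquareSLE)
    (hT : SAWTrackTransport.YBtoUniform) : _root_.SAWScalingLimit :=
  Sketch.sawScalingLimit_of_ybSquareSLE_of_surfaceUniversality hY
    (surfaceUniversality_of_toll hY hT)

/-- **Conversely, the registered line also pays the toll**: under `YBSquareSLE`, `SurfaceUniversality`
(hence its two registered stubs `PlusPointIsZ2`, `SurfaceTransport` of `Lines/birth.lean`) gives
`SAWTrackTransport.YBtoUniform` — so 6964 and 16966 are equivalent given 6967, and are one problem for
staffing purposes. [folklore] -/
theorem ybToUniform_of_surfaceUniversality (hY : SAWCompassLattice.YBSquareSLE)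
    (hU : SAWCompassLattice.SurfaceUniversality) : SAWTrackTransport.YBtoUniform := by
  intro D a b a' b' hab hab' f
  obtain ⟨α, β, s, z, hsol⟩ := Sketch.stub_compassRealisation
  have hU' := Cruxes.HexTransfer.Sketch.Surface.surfaceUniversality_iff.1 hU α β s z hsol D a b a' b'
    hab hab' f
  have h := hU'.sub (yb_compass_merge hY α β s z hsol D a' b' hab' f)
  rw [sub_zero] at h
  exact h.congr fun δ => sub_sub_sub_cancel_right _ _ _

end Summit.CriticalPhenomena.SAWScalingLimit.Cruxes.SurfaceUniversality.Toll

end
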